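import Summits.NavierStokesRegularity.NavierStokesRegularity.Theorems.TautCompressionIntegrable.Negative.FalseWithoutMomentum

/-!
# `TautCompressionIntegrable` is false without the momentum equation even in the energy class, part 5

Negative-side support for the crux `TautLoopKelvin.TautCompressionIntegrable`
(stmt-NavierStokesRegularity-15248), cdisprove seat, 2026-08-17. The witness of part 4 (Leray's backward
zoom `u = λV_δ(λ·)`, `λ = (1 − t)^{-1/2}`) lies in the Leray–Hopf REGULARITY CLASS: `∫|u(t)|² =
λ⁻¹∫|V_δ|² ≤ ∫|V_δ|² < ∞` uniformly on `[0,1)` (`lintegral_sq_uW_le`) and `∫₀¹∫|∇u|² = (∫|∇V_δ|²)∫₀¹λ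
< ∞` (`lintegral_lintegral_sq_fderiv_uW_lt_top`). Hence the crux with the Navier–Stokes system replaced
by smoothness + incompressibility + decay + `u ∈ L^∞L² ∩ L²Ḣ¹` is still FALSE
(`tautCompressionIntegrable_false_without_momentum_energyClass`): what a proof must take from the
equation is the dynamics (local energy inequality / exclusion of self-similar collapse), not
function-space membership. Theorems only; nothing here asserts a Theses statement.
-/

noncomputable section

namespace Summit.NavierStokesRegularity.NavierStokesRegularity.Theorems.TautCompressionIntegrable.Negative

open MeasureTheory Set Filter Metric Real intervalIntegral InnerProductSpace
open scoped ENNReal RealInnerProductSpace ContDiff Topology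
open Literature.Analysis.FluidPDE

set_option linter.dupNamespace false

local notation "ℝ³" => EuclideanSpace ℝ (Fin 3)

/-! ## The witness lies in the Leray–Hopf energy class `L^∞_t L²_x ∩ L²_t Ḣ¹_x` -/

/-- The Leray scale is at least `1` on `[0, 1)`. -/
theorem one_le_scale {t : ℝ} (h0 : 0 ≤ t) (ht : t < 1) : 1 ≤ (Real.sqrt (2 * (1 / 2) * (1 - t)))⁻¹ := by
  rw [show 2 * (1 / 2) * (1 - t) = 1 - t by ring,
    one_le_inv_iff₀]
  refine ⟨Real.sqrt_pos.2 (by linarith), ?_⟩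
  calc Real.sqrt (1 - t) ≤ Real.sqrt 1 := Real.sqrt_le_sqrt (by linarith)
    _ = 1 := Real.sqrt_one

/-- A continuous compactly supported field has finite `∫ |·|²`. -/
theorem lintegral_enorm_sq_lt_top_of_hasCompactSupport {F : Type*} [NormedAddCommGroup F]
    {f : ℝ³ → F} (hf : Continuous f) (hc : HasCompactSupport f) : ∫⁻ x, ‖f x‖ₑ ^ 2 < ⊤ := by
  have hsupp : HasCompactSupport ((fun x => ‖f x‖) * fun x => ‖f x‖) := hc.norm.mul_right
  have hint : Integrable (fun x => ‖f x‖ * ‖f x‖) :=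
    (hf.norm.mul hf.norm).integrable_of_hasCompactSupport hsupp
  have h := hint.lintegral_lt_top
  refine lt_of_le_of_lt (le_of_eq (lintegral_congr fun x => ?_)) h
  rw [← ofReal_norm, sq, ← ENNReal.ofReal_mul (norm_nonneg _)]

/-- **Uniform `L²` bound along the zoom**: `∫ |u(t)|² = λ(t)⁻¹ ∫ |V_δ|² ≤ ∫ |V_δ|²` for `0 ≤ t < 1`
(the zoom is `L²`-subcritical: the energy DEcreases to `0`). -/
theorem lintegral_sq_uW_le (δ : ℝ) {t : ℝ} (h0 : 0 ≤ t) (ht : t < 1) :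
    ∫⁻ x, ‖uW δ t x‖ₑ ^ 2 ≤ ∫⁻ x, ‖vW δ x‖ₑ ^ 2 := by
  set c : ℝ := (Real.sqrt (2 * (1 / 2) * (1 - t)))⁻¹ with hc_def
  have hc : 0 < c := scale_pos ht
  have h1c : 1 ≤ c := one_le_scale h0 ht
  have hstep : ∫⁻ x, ‖uW δ t x‖ₑ ^ 2 = ENNReal.ofReal (c ^ 2) * ∫⁻ x, ‖vW δ (c • x)‖ₑ ^ 2 := by
    rw [← lintegral_const_mul' _ _ ENNReal.ofReal_ne_top]
    refine lintegral_congr fun x => ?_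
    show ‖c • vW δ (c • x)‖ₑ ^ 2 = _
    rw [enorm_smul, mul_pow, Real.enorm_eq_ofReal hc.le, ENNReal.ofReal_pow hc.le]
  rw [hstep, lintegral_comp_smul (fun x => ‖vW δ x‖ₑ ^ 2) hc.ne', finrank_euclideanSpace_fin,
    abs_of_pos (by positivity), ← mul_assoc, ← ENNReal.ofReal_mul (by positivity)]
  have hcc : c ^ 2 * (c ^ 3)⁻¹ = c⁻¹ := by field_simp
  rw [hcc]
  calc ENNReal.ofReal c⁻¹ * ∫⁻ x, ‖vW δ x‖ₑ ^ 2 ≤ 1 * ∫⁻ x, ‖vW δ x‖ₑ ^ 2 := by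
        gcongr
        rw [← ENNReal.ofReal_one]
        exact ENNReal.ofReal_le_ofReal (inv_le_one_of_one_le₀ h1c)
    _ = ∫⁻ x, ‖vW δ x‖ₑ ^ 2 := one_mul _

/-- `∫ |V_δ|² < ∞`. -/
theorem lintegral_sq_vW_lt_top (δ : ℝ) : ∫⁻ x, ‖vW δ x‖ₑ ^ 2 < ⊤ :=
  lintegral_enorm_sq_lt_top_of_hasCompactSupport (contDiff_vW δ).continuous (hasCompactSupport_vW δ)

/-- `∫ |∇V_δ|² < ∞`. -/
theorem lintegral_sq_fderiv_vW_lt_top (δ : ℝ) : ∫⁻ x, ‖fderiv ℝ (vW δ) x‖ₑ ^ 2 < ⊤ :=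
  lintegral_enorm_sq_lt_top_of_hasCompactSupport ((contDiff_vW δ).continuous_fderiv (by simp))
    ((hasCompactSupport_vW δ).fderiv (𝕜 := ℝ))

/-- **The enstrophy of a slice of the zoom**: `∫ |∇u(t)|² = λ(t) ∫ |∇V_δ|²` for `t < 1`. -/
theorem lintegral_sq_fderiv_uW (δ : ℝ) {t : ℝ} (ht : t < 1) :
    ∫⁻ x, ‖fderiv ℝ (uW δ t) x‖ₑ ^ 2 =
      ENNReal.ofReal ((Real.sqrt (2 * (1 / 2) * (1 - t)))⁻¹) * ∫⁻ x, ‖fderiv ℝ (vW δ) x‖ₑ ^ 2 := by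
  set c : ℝ := (Real.sqrt (2 * (1 / 2) * (1 - t)))⁻¹ with hc_def
  have hc : 0 < c := scale_pos ht
  have hstep : ∫⁻ x, ‖fderiv ℝ (uW δ t) x‖ₑ ^ 2 =
      ENNReal.ofReal (c ^ 4) * ∫⁻ x, ‖fderiv ℝ (vW δ) (c • x)‖ₑ ^ 2 := by
    rw [← lintegral_const_mul' _ _ ENNReal.ofReal_ne_top]
    refine lintegral_congr fun x => ?_
    rw [uW, fderiv_lerayBackward, ← hc_def, enorm_smul, mul_pow, Real.enorm_eq_ofReal (sq_nonneg _),
      ← ENNReal.ofReal_pow (sq_nonneg _), show (c ^ 2) ^ 2 = c ^ 4 by ring]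
  rw [hstep, lintegral_comp_smul (fun x => ‖fderiv ℝ (vW δ) x‖ₑ ^ 2) hc.ne', finrank_euclideanSpace_fin,
    abs_of_pos (by positivity), ← mul_assoc, ← ENNReal.ofReal_mul (by positivity)]
  have hcc : c ^ 4 * (c ^ 3)⁻¹ = c := by field_simp
  rw [hcc]

/-- `∫₀¹ λ(t) dt < ∞` (`λ = (1 − t)^{-1/2}`). -/
theorem lintegral_scale_lt_top :
    ∫⁻ t in Set.Ioo (0:ℝ) 1, ENNReal.ofReal ((Real.sqrt (2 * (1 / 2) * (1 - t)))⁻¹) < ⊤ := by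
  have h1 : IntervalIntegrable (fun x : ℝ => x ^ (-(1 / 2) : ℝ)) volume 0 1 :=
    intervalIntegral.intervalIntegrable_rpow' (by norm_num)
  have h2 : IntervalIntegrable (fun x : ℝ => (1 - x) ^ (-(1 / 2) : ℝ)) volume 0 1 := by
    simpa using (h1.comp_sub_left 1).symm
  have h3 : IntegrableOn (fun x : ℝ => (1 - x) ^ (-(1 / 2) : ℝ)) (Set.Ioo 0 1) :=
    (intervalIntegrable_iff_integrableOn_Ioo_of_le zero_le_one).1 h2
  have h4 := h3.lintegral_lt_top
  refine lt_of_le_of_lt (le_of_eq ?_) h4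
  refine setLIntegral_congr_fun measurableSet_Ioo fun t ht => ?_
  rw [show 2 * (1 / 2) * (1 - t) = 1 - t by ring, Real.sqrt_eq_rpow,
    ← Real.rpow_neg (by linarith [ht.2])]

/-- **`∫₀¹ ∫ |∇u|² < ∞`**: the zoom has finite total dissipation (`∫ λ dt < ∞`). -/
theorem lintegral_lintegral_sq_fderiv_uW_lt_top (δ : ℝ) :
    ∫⁻ t in Set.Ioo (0:ℝ) 1, ∫⁻ x, ‖fderiv ℝ (uW δ t) x‖ₑ ^ 2 < ⊤ := by
  have hmeas : Measurable fun t : ℝ => ENNReal.ofReal ((Real.sqrt (2 * (1 / 2) * (1 - t)))⁻¹) :=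
    ((measurable_const.mul (measurable_const.sub measurable_id)).sqrt.inv).ennreal_ofReal
  rw [setLIntegral_congr_fun measurableSet_Ioo (fun t ht => lintegral_sq_fderiv_uW δ ht.2),
    lintegral_mul_const _ hmeas]
  exact ENNReal.mul_lt_top lintegral_scale_lt_top (lintegral_sq_fderiv_vW_lt_top δ)

/-- **Even in the energy class the momentum equation is load-bearing**: the crux without the
Navier–Stokes system is false also when the kinematic hypotheses are supplemented by the full
Leray–Hopf REGULARITY CLASS `u ∈ L^∞(0,T; L²) ∩ L²(0,T; Ḣ¹)` (uniform bound of `∫|u(t)|²` on `[0,T)`,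
finite `∫₀ᵀ∫|∇u|²`). Same witness: the Leray zoom is `L²`-subcritical (`∫|u(t)|² = λ⁻¹∫|V_δ|²`) with
integrable enstrophy (`∫|∇u(t)|² = λ∫|∇V_δ|²`, `∫₀¹λ = 2`). What the crux needs from the equation is
therefore not function-space membership but the dynamics itself (local energy inequality / exclusion
of Leray-type self-similar collapse, Nečas–Růžička–Šverák 1996, Tsai 1998). -/
theorem tautCompressionIntegrable_false_without_momentum_energyClass :
    ¬ (∀ (ν T : ℝ), 0 < ν → 0 < T → ∀ (u : ℝ → ℝ³ → ℝ³),
        IsSmoothSpaceTimeOn (Set.Ico 0 T) u →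
        (∀ t ∈ Set.Ico 0 T, VectorCalculus.IsDivFree (u t)) →
        (∀ t ∈ Set.Ico 0 T, HasRapidSpatialDecay (u t)) →
        (∃ E : ℝ≥0∞, E < ⊤ ∧ ∀ t ∈ Set.Ico 0 T, ∫⁻ x, ‖u t x‖ₑ ^ 2 ≤ E) →
        (∫⁻ t in Set.Ioo 0 T, ∫⁻ x, ‖fderiv ℝ (u t) x‖ₑ ^ 2) < ⊤ →
        ∀ g : ℝ, 0 < g → ∃ (Φ : ℝ → ℝ) (M : ℝ), Measurable Φ ∧ 0 ≤ M ∧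
          (∀ s ∈ Set.Ioo 0 T, (⨅ ε : {ε : ℝ // 0 < ε}, sSup {k : ℝ | ∃ γ : ℝ → ℝ³,
            IsC1Loop γ ∧ g ≤ |circulation (u s) γ| ∧
            ENNReal.ofReal (∫ σ in (0:ℝ)..1, ‖deriv γ σ‖) ≤
              (⨅ (γ' : ℝ → ℝ³) (_ : IsC1Loop γ' ∧ g ≤ |circulation (u s) γ'|),
                ENNReal.ofReal (∫ σ in (0:ℝ)..1, ‖deriv γ' σ‖)) + ENNReal.ofReal (ε : ℝ) ∧
            k = ((∫ σ in (0:ℝ)..1, -(inner ℝ (deriv γ σ) (fderiv ℝ (u s) (γ σ) (deriv γ σ))) /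
              ‖deriv γ σ‖) / (∫ σ in (0:ℝ)..1, ‖deriv γ σ‖))}) ≤ Φ s) ∧
          (∫⁻ s in Set.Ioo 0 T, ENNReal.ofReal (Φ s)) ≤ ENNReal.ofReal M) := by
  intro h
  obtain ⟨δ, C, hδ, hC, hδC⟩ := exists_delta
  exact uW_no_majorant hδ hC hδC (h 1 1 one_pos one_pos (uW δ) (isSmoothSpaceTimeOn_uW δ)
    (fun t _ => isDivFree_uW δ t) (fun t ht => hasRapidSpatialDecay_uW δ ht.2)
    ⟨∫⁻ x, ‖vW δ x‖ₑ ^ 2, lintegral_sq_vW_lt_top δ, fun t ht => lintegral_sq_uW_le δ ht.1 ht.2⟩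
    (lintegral_lintegral_sq_fderiv_uW_lt_top δ) (2 * π) two_pi_pos)

end Summit.NavierStokesRegularity.NavierStokesRegularity.Theorems.TautCompressionIntegrable.Negative

end
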